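import Summits.AtomisticToContinuum.BoseEinsteinCondensation.Theorems.BECInsertionCorrectorStaticResponseBoundFreeSquare
import HarnessLib

/-!
# The gauged completed square for the static response bound, I: the torus identity

Helper file (part 1 of 2) for stub `stub_gaugedSquare` of the few-body layer of line
`stable-fraction-square-completion` of crux `BECInsertionCorrector.StaticResponseBound`
(item stmt-AtomisticToContinuum-12057; this file supports, does not close, the item; its
registered form is `stub_gaugedSquareIdentity`).

Setting: `N` bosons on the torus of side `L > 0`, a wave vector `k ≠ 0`, `p = 2πk/L`,
`|p|² = psq L k`, the phases `θⱼ(X) = p·xⱼ` (continuous linear functionals `Θⱼ` of the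
configuration), `u_c = t p_c/|p|²`, and a periodic trial state `Ψ`. The companion file
`…FreeSquare.lean` completes the square `∑_{j,c} |∂_{j,c}Ψ − u_c sin θⱼ Ψ|² ≥ 0` particle by
particle and axis by axis and DROPS it; here the square is KEPT:

* `gaugedSq_axis`: `∫ |∂_{j,c}Ψ − u sin θⱼ Ψ|² = ∫ |∂_{j,c}Ψ|² + u p_c ∫ cos θⱼ |Ψ|² + u² ∫ sin²θⱼ |Ψ|²`
  (expansion of the square in the real inner product space `ℂ`, `∂_{j,c}|Ψ|² = 2Re⟨Ψ, ∂_{j,c}Ψ⟩`,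
  and torus integration by parts of the flux `sin θⱼ |Ψ|²`, `integral_cellN_pderiv_eq_zero`);
* `gaugedSq_sum`: summing over `c` (`∑_c u_c p_c = t`, `∑_c u_c² = t²/|p|²`, `∫ sin²θⱼ|Ψ|² ≤ 1`) and
  over `j`: `∫ ∑_{j,c}|∂_{j,c}Ψ − u_c sin θⱼ Ψ|² − N t²/|p|² ≤ ∫ |∇Ψ|² + t⟨∑ⱼ cos θⱼ⟩_Ψ`;
* `gaugedSq_fderiv_gauge`: for the gauge `S = (t/|p|²)∑ⱼ cos θⱼ` and `G = e^{S}ψ`,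
  `∂_{j,c}G = e^{S}(∂_{j,c}ψ − u_c sin θⱼ ψ)`, i.e. the kept square is `e^{-2S}|∇G|²`.

Part 2 (`…GaugedSquare.lean`) bounds the kept square below by the ground-state energy. All
ingredients are folklore torus calculus.
-/

noncomputable section

namespace Summit.AtomisticToContinuum.BoseEinsteinCondensation.Cruxes.StaticResponseBound.FewBody

open MeasureTheory Filter
open scoped ENNReal NNReal BigOperators RealInnerProductSpace
open Literature.MathematicalPhysics.QuantumManyBody.BoseGas
open Summit.AtomisticToContinuum.BoseEinsteinCondensation.Theses.BECInsertionCorrector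
open Summit.AtomisticToContinuum.BoseEinsteinCondensation.Theorems.StaticResponseBound.Negative
open Summit.AtomisticToContinuum.BoseEinsteinCondensation.Cruxes.StaticResponseBound.UvThomsonForceWave

variable {N : ℕ}

/-! ## The phases `θⱼ = p·xⱼ` and the gauge -/

/-- `Θ_{j'}(e_{j,c}) = δ_{j,j'} p_c`: the phase of particle `j'` only sees the coordinates of
particle `j'`. [folklore] -/
theorem gaugedSq_phase_single {L : ℝ} {k : Fin 3 → ℤ} {j' : Fin N} (Θ : Config N →L[ℝ] ℝ)
    (hΘ : ∀ X, Θ X = 2 * Real.pi / L * ∑ i, (k i : ℝ) * X j' i) (j : Fin N) (c : Fin 3) :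
    Θ (Pi.single j (EuclideanSpace.single c 1)) =
      if j' = j then 2 * Real.pi / L * k c else 0 := by
  rw [hΘ]
  split_ifs with h
  · subst h
    simp only [Pi.single_eq_same, PiLp.single_apply, mul_ite, mul_one, mul_zero,
      Finset.sum_ite_eq', Finset.mem_univ, if_true]
  · rw [Pi.single_eq_of_ne h]
    simp

/-- The phases are `2πℤ`-valued on the period lattice: `Θ_j(L e_{i,a}) ∈ 2πℤ`. [folklore] -/
theorem gaugedSq_phase_period {L : ℝ} (hL : L ≠ 0) {k : Fin 3 → ℤ} {j : Fin N} (Θ : Config N →L[ℝ] ℝ)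
    (hΘ : ∀ X, Θ X = 2 * Real.pi / L * ∑ i, (k i : ℝ) * X j i) (i : Fin N) (a : Fin 3) :
    ∃ m : ℤ, Θ (Pi.single i (EuclideanSpace.single a L)) = m * (2 * Real.pi) := by
  rcases eq_or_ne i j with rfl | hne
  · refine ⟨k a, ?_⟩
    rw [hΘ]
    simp only [Pi.single_eq_same, PiLp.single_apply, mul_ite, mul_zero, Finset.sum_ite_eq',
      Finset.mem_univ, if_true]
    field_simp
  · refine ⟨0, ?_⟩
    rw [hΘ, Pi.single_eq_of_ne' hne]
    simp

/-- **Derivative of the gauged function.** With `S = (t/P) ∑ⱼ cos Θⱼ` and `G = e^{S} ψ`: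
`∂_{j,c} G = e^{S} (∂_{j,c} ψ - u_c sin Θⱼ · ψ)`, `u_c = t p_c / P` (`∂_{j,c} S = -u_c sin Θⱼ`).
[folklore] -/
theorem gaugedSq_fderiv_gauge {L : ℝ} {k : Fin 3 → ℤ} (t P : ℝ) {ψ : Config N → ℂ}
    (hψ : Differentiable ℝ ψ) (Θ : Fin N → Config N →L[ℝ] ℝ)
    (hΘ : ∀ j X, Θ j X = 2 * Real.pi / L * ∑ i, (k i : ℝ) * X j i)
    {S : Config N → ℝ} (hS : ∀ X, S X = t / P * ∑ j, Real.cos (Θ j X))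
    {G : Config N → ℂ} (hG : ∀ X, G X = Real.exp (S X) • ψ X) (X : Config N) (j : Fin N)
    (c : Fin 3) :
    fderiv ℝ G X (Pi.single j (EuclideanSpace.single c 1)) =
      Real.exp (S X) • (fderiv ℝ ψ X (Pi.single j (EuclideanSpace.single c 1))
        - (t * (2 * Real.pi / L * k c) / P * Real.sin (Θ j X)) • ψ X) := by
  have hSf : S = fun Y => t / P * ∑ j', Real.cos (Θ j' Y) := funext hS
  have hGf : G = fun Y => Real.exp (S Y) • ψ Y := funext hG
  have hSd : HasFDerivAt S
      ((t / P) • ∑ j', -Real.sin (Θ j' X) • (Θ j' : Config N →L[ℝ] ℝ)) X := by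
    rw [hSf]
    exact (HasFDerivAt.fun_sum (u := Finset.univ) fun j' _ =>
      (Real.hasDerivAt_cos (Θ j' X)).comp_hasFDerivAt X (Θ j').hasFDerivAt).const_mul (t / P)
  have hGd : HasFDerivAt G (Real.exp (S X) • fderiv ℝ ψ X +
      (Real.exp (S X) • ((t / P) • ∑ j', -Real.sin (Θ j' X) • (Θ j' : Config N →L[ℝ] ℝ))).smulRight
        (ψ X)) X := by
    rw [hGf]
    exact ((Real.hasDerivAt_exp (S X)).comp_hasFDerivAt X hSd).fun_smul (hψ X).hasFDerivAt
  have hΘe : ∀ j', Θ j' (Pi.single j (EuclideanSpace.single c 1)) =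
      if j' = j then 2 * Real.pi / L * k c else 0 := fun j' => gaugedSq_phase_single (Θ j') (hΘ j') j c
  rw [hGd.fderiv]
  simp only [add_apply, FunLike.coe_smul, Pi.smul_apply,
    ContinuousLinearMap.smulRight_apply, FunLike.coe_sum, Finset.sum_apply,
    hΘe, smul_eq_mul, mul_ite, mul_zero, Finset.sum_ite_eq', Finset.mem_univ, if_true]
  simp only [Complex.real_smul]
  push_cast
  ring


/-! ## The completed square, kept -/

/-- **The gauged completed square for particle `j` and axis `c`, square kept.** With
`θ = Θⱼ`, `F = |Ψ|²`, `p = p_c = 2πk_c/L` and any real `u`: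
`∫ |∂_{j,c}Ψ − u sin θ Ψ|² = ∫ |∂_{j,c}Ψ|² + u p ∫ cos θ F + u² ∫ sin²θ F`
(expand the square in the real inner product space `ℂ`, `∂_{j,c}F = 2Re⟨Ψ, ∂_{j,c}Ψ⟩`, and torus
integration by parts of the flux `sin θ F`: `∫ (p cos θ F + sin θ ∂_{j,c}F) = 0`). [folklore] -/
theorem gaugedSq_axis {L : ℝ} (hL : 0 < L) {k : Fin 3 → ℤ} (Ψ : PeriodicTrialState N L)
    {j : Fin N} {c : Fin 3} (Θ : Config N →L[ℝ] ℝ) {F : Config N → ℝ} {p : ℝ}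
    (hΘ : ∀ X, Θ X = 2 * Real.pi / L * ∑ i, (k i : ℝ) * X j i) (hF : ∀ X, F X = ‖Ψ.ψ X‖ ^ 2)
    (hp : p = 2 * Real.pi / L * k c) (u : ℝ) :
    ∫ X in cellN N L, ‖fderiv ℝ Ψ.ψ X (Pi.single j (EuclideanSpace.single c 1))
        - (u * Real.sin (Θ X)) • Ψ.ψ X‖ ^ 2 =
      (∫ X in cellN N L, ‖fderiv ℝ Ψ.ψ X (Pi.single j (EuclideanSpace.single c 1))‖ ^ 2)
        + u * p * (∫ X in cellN N L, Real.cos (Θ X) * F X)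
        + u ^ 2 * (∫ X in cellN N L, Real.sin (Θ X) ^ 2 * F X) := by
  -- adapted from `freeSq_axis` (Theorems/BECInsertionCorrectorStaticResponseBoundFreeSquare.lean)
  -- regularity
  have hψ1 : ContDiff ℝ 1 Ψ.ψ := Ψ.contDiff
  have hψd : Differentiable ℝ Ψ.ψ := hψ1.differentiable one_ne_zero
  have hFeq : F = fun X => ‖Ψ.ψ X‖ ^ 2 := funext hF
  have hF1 : ContDiff ℝ 1 F := by rw [hFeq]; exact hψ1.norm_sq ℂ
  have hFd : Differentiable ℝ F := hF1.differentiable one_ne_zero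
  have hS1 : ContDiff ℝ 1 fun X => Real.sin (Θ X) := Real.contDiff_sin.comp Θ.contDiff
  have hcf : Continuous (fderiv ℝ Ψ.ψ) := hψ1.continuous_fderiv one_ne_zero
  have hψc : Continuous Ψ.ψ := hψ1.continuous
  have hFc : Continuous F := hF1.continuous
  have hdFc : Continuous (pderiv j c F) := continuous_pderiv hF1 j c
  have hΘc : Continuous Θ := Θ.continuous
  -- the flux `sin θ · F` is `C¹` and lattice periodic; integration by parts on the torus
  have hG1 : ContDiff ℝ 1 fun X => Real.sin (Θ X) * F X := hS1.mul hF1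
  have hGper : IsLatticePeriodic L fun X => Real.sin (Θ X) * F X := by
    intro X j' c'
    obtain ⟨m, hm⟩ := gaugedSq_phase_period hL.ne' Θ hΘ j' c'
    dsimp only
    rw [hF, hF, Ψ.periodic, map_add, hm, Real.sin_add_int_mul_two_pi]
  have hIBP := integral_cellN_pderiv_eq_zero hL hG1 hGper j c
  have hΘe : Θ (Pi.single j (EuclideanSpace.single c 1)) = p := by
    rw [gaugedSq_phase_single Θ hΘ j c, if_pos rfl, hp]
  have hderiv : ∀ X, pderiv j c (fun Y => Real.sin (Θ Y) * F Y) X =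
      p * Real.cos (Θ X) * F X + Real.sin (Θ X) * pderiv j c F X := by
    intro X
    rw [pderiv_fun_mul (hS1.differentiable one_ne_zero X) (hFd X), freeSq_pderiv_sin_clm, hΘe]
    ring
  simp_rw [hderiv] at hIBP
  -- the pointwise expansion of the square: integrand = (kept terms) - u · (divergence)
  have hpt : ∀ X, ‖fderiv ℝ Ψ.ψ X (Pi.single j (EuclideanSpace.single c 1))
        - (u * Real.sin (Θ X)) • Ψ.ψ X‖ ^ 2 =
      (‖fderiv ℝ Ψ.ψ X (Pi.single j (EuclideanSpace.single c 1))‖ ^ 2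
        + u * p * (Real.cos (Θ X) * F X) + u ^ 2 * (Real.sin (Θ X) ^ 2 * F X))
      - u * (p * Real.cos (Θ X) * F X + Real.sin (Θ X) * pderiv j c F X) := by
    intro X
    have h2 : pderiv j c F X =
        2 * ⟪Ψ.ψ X, fderiv ℝ Ψ.ψ X (Pi.single j (EuclideanSpace.single c 1))⟫ := by
      rw [hFeq, pderiv, (hψd X).hasFDerivAt.norm_sq.fderiv]
      simp [two_smul, two_mul]
    rw [norm_sub_sq_real, real_inner_smul_right, real_inner_comm, norm_smul, Real.norm_eq_abs,
      mul_pow, sq_abs, h2, hF X]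
    ring
  -- integrability of everything in sight (continuous functions on the bounded cell)
  have hiA : Integrable (fun X => ‖fderiv ℝ Ψ.ψ X (Pi.single j (EuclideanSpace.single c 1))‖ ^ 2
      + u * p * (Real.cos (Θ X) * F X) + u ^ 2 * (Real.sin (Θ X) ^ 2 * F X))
      (volume.restrict (cellN N L)) := integrableOn_cellN (by fun_prop) L
  have hiB : Integrable (fun X => p * Real.cos (Θ X) * F X + Real.sin (Θ X) * pderiv j c F X)
      (volume.restrict (cellN N L)) := integrableOn_cellN (by fun_prop) L
  have hi1 : Integrable (fun X => ‖fderiv ℝ Ψ.ψ X (Pi.single j (EuclideanSpace.single c 1))‖ ^ 2)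
      (volume.restrict (cellN N L)) :=
    integrableOn_cellN ((hcf.clm_apply continuous_const).norm.pow 2) L
  have hi2 : Integrable (fun X => Real.cos (Θ X) * F X) (volume.restrict (cellN N L)) :=
    integrableOn_cellN (by fun_prop) L
  have hi3 : Integrable (fun X => Real.sin (Θ X) ^ 2 * F X) (volume.restrict (cellN N L)) :=
    integrableOn_cellN (by fun_prop) L
  have hi12 : Integrable (fun X => ‖fderiv ℝ Ψ.ψ X (Pi.single j (EuclideanSpace.single c 1))‖ ^ 2
      + u * p * (Real.cos (Θ X) * F X)) (volume.restrict (cellN N L)) := hi1.add (hi2.const_mul _)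
  rw [integral_congr_ae (Eventually.of_forall hpt), integral_sub hiA (hiB.const_mul u),
    integral_const_mul, hIBP, mul_zero, sub_zero, integral_add hi12 (hi3.const_mul _),
    integral_add hi1 (hi2.const_mul _), integral_const_mul, integral_const_mul]

/-- **The gauged completed square, summed over particles and axes.** With `u_c = t p_c/|p|²`,
`θⱼ = p·xⱼ` and the square density `sq = ∑_{j,c} |∂_{j,c}Ψ − u_c sin θⱼ Ψ|²`:
`∫ sq − N t²/|p|² ≤ ∫ |∇Ψ|² + t ⟨∑ⱼ cos θⱼ⟩_Ψ`
(sum of `gaugedSq_axis`: `∑_c u_c p_c = t`, `∑_c u_c² = t²/|p|²`, `∫ sin²θⱼ |Ψ|² ≤ 1`). [folklore] -/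
theorem gaugedSq_sum {L : ℝ} (hL : 0 < L) {k : Fin 3 → ℤ} (hk : k ≠ 0) (t : ℝ)
    (Ψ : PeriodicTrialState N L) (Θ : Fin N → Config N →L[ℝ] ℝ) {u : Fin 3 → ℝ}
    {sqd kin : Config N → ℝ}
    (hΘ : ∀ j X, Θ j X = 2 * Real.pi / L * ∑ i, (k i : ℝ) * X j i)
    (hu : ∀ c, u c = t * (2 * Real.pi / L * k c) / psq L k)
    (hsq : ∀ X, sqd X = ∑ j, ∑ c, ‖fderiv ℝ Ψ.ψ X (Pi.single j (EuclideanSpace.single c 1))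
        - (u c * Real.sin (Θ j X)) • Ψ.ψ X‖ ^ 2)
    (hkin : ∀ X, kin X = ∑ j, ∑ c, ‖fderiv ℝ Ψ.ψ X (Pi.single j (EuclideanSpace.single c 1))‖ ^ 2) :
    (∫ X in cellN N L, sqd X) - N * t ^ 2 / psq L k ≤
      (∫ X in cellN N L, kin X) + t * cosMean L k Ψ := by
  -- adapted from `stub_freeSquare` (Theorems/BECInsertionCorrectorStaticResponseBoundFreeSquare.lean)
  obtain ⟨F, hF⟩ : ∃ F : Config N → ℝ, ∀ X, F X = ‖Ψ.ψ X‖ ^ 2 := ⟨_, fun _ => rfl⟩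
  obtain ⟨p, hp⟩ : ∃ p : Fin 3 → ℝ, ∀ c, p c = 2 * Real.pi / L * k c := ⟨_, fun _ => rfl⟩
  have hP : 0 < psq L k := freeSq_psq_pos hL hk
  have hPsum : psq L k = ∑ c, p c ^ 2 := by
    rw [freeSq_psq_eq_sum]; exact Finset.sum_congr rfl fun c _ => by rw [hp]
  have hu' : ∀ c, u c = t * p c / psq L k := fun c => by rw [hu, hp]
  -- continuity and integrability
  have hψ1 : ContDiff ℝ 1 Ψ.ψ := Ψ.contDiff
  have hcf : Continuous (fderiv ℝ Ψ.ψ) := hψ1.continuous_fderiv one_ne_zero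
  have hψc : Continuous Ψ.ψ := hψ1.continuous
  have hFc : Continuous F := by rw [funext hF]; exact (hψc.norm).pow 2
  have hIcos : ∀ j, Integrable (fun X => Real.cos (Θ j X) * F X) (volume.restrict (cellN N L)) :=
    fun j => integrableOn_cellN ((Real.continuous_cos.comp (Θ j).continuous).mul hFc) L
  have hIsin : ∀ j, Integrable (fun X => Real.sin (Θ j X) ^ 2 * F X)
      (volume.restrict (cellN N L)) :=
    fun j => integrableOn_cellN (((Real.continuous_sin.comp (Θ j).continuous).pow 2).mul hFc) L
  have hIa : ∀ j c, Integrable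
      (fun X => ‖fderiv ℝ Ψ.ψ X (Pi.single j (EuclideanSpace.single c 1))‖ ^ 2)
      (volume.restrict (cellN N L)) :=
    fun j c => integrableOn_cellN ((hcf.clm_apply continuous_const).norm.pow 2) L
  have hID : ∀ j c, Integrable (fun X => ‖fderiv ℝ Ψ.ψ X (Pi.single j (EuclideanSpace.single c 1))
      - (u c * Real.sin (Θ j X)) • Ψ.ψ X‖ ^ 2) (volume.restrict (cellN N L)) :=
    fun j c => integrableOn_cellN (((hcf.clm_apply continuous_const).sub
      ((continuous_const.mul (Real.continuous_sin.comp (Θ j).continuous)).smul hψc)).norm.pow 2) L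
  -- `∫ sin²θⱼ |Ψ|² ≤ ∫ |Ψ|² = 1`
  have hsinF : ∀ j, ∫ X in cellN N L, Real.sin (Θ j X) ^ 2 * F X ≤ 1 := by
    intro j
    rw [← integral_norm_sq_eq_one Ψ]
    refine integral_mono (hIsin j) (integrableOn_cellN ((hψc.norm).pow 2) L) fun X => ?_
    dsimp only
    rw [hF X]
    have h1 : Real.sin (Θ j X) ^ 2 ≤ 1 := by
      rw [sq_le_one_iff_abs_le_one]; exact Real.abs_sin_le_one _
    nlinarith [sq_nonneg ‖Ψ.ψ X‖]
  -- per particle: the axis identity summed over the axes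
  have hj : ∀ j, ∑ c, ∫ X in cellN N L, ‖fderiv ℝ Ψ.ψ X (Pi.single j (EuclideanSpace.single c 1))
        - (u c * Real.sin (Θ j X)) • Ψ.ψ X‖ ^ 2 ≤
      (∑ c, ∫ X in cellN N L, ‖fderiv ℝ Ψ.ψ X (Pi.single j (EuclideanSpace.single c 1))‖ ^ 2)
        + t * (∫ X in cellN N L, Real.cos (Θ j X) * F X) + t ^ 2 / psq L k := by
    intro j
    rw [Finset.sum_congr rfl fun c (_ : c ∈ Finset.univ) => gaugedSq_axis hL Ψ (Θ j) (hΘ j) hF (hp c) (u c),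
      Finset.sum_add_distrib, Finset.sum_add_distrib, ← Finset.sum_mul, ← Finset.sum_mul]
    have e1 : ∑ c, u c * p c = t := by
      simp_rw [hu']
      rw [show ∑ c, t * p c / psq L k * p c = t / psq L k * ∑ c, p c ^ 2 from by
        rw [Finset.mul_sum]; exact Finset.sum_congr rfl fun c _ => by ring, ← hPsum]
      field_simp
    have e2 : ∑ c, u c ^ 2 = t ^ 2 / psq L k := by
      simp_rw [hu']
      rw [show ∑ c, (t * p c / psq L k) ^ 2 = t ^ 2 / psq L k ^ 2 * ∑ c, p c ^ 2 from by
        rw [Finset.mul_sum]; exact Finset.sum_congr rfl fun c _ => by ring, ← hPsum]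
      field_simp
    rw [e1, e2]
    have h3 : t ^ 2 / psq L k * (∫ X in cellN N L, Real.sin (Θ j X) ^ 2 * F X) ≤ t ^ 2 / psq L k :=
      mul_le_of_le_one_right (by positivity) (hsinF j)
    linarith
  -- sum over the particles
  have hsum := Finset.sum_le_sum fun j (_ : j ∈ Finset.univ) => hj j
  rw [Finset.sum_add_distrib, Finset.sum_add_distrib, ← Finset.mul_sum, Finset.sum_const,
    Finset.card_univ, Fintype.card_fin, nsmul_eq_mul] at hsum
  -- the sums of integrals are integrals of sums, and `⟨∑ⱼ cos θⱼ⟩_Ψ`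
  have hcm : cosMean L k Ψ = ∑ j, ∫ X in cellN N L, Real.cos (Θ j X) * F X := by
    rw [← integral_finsetSum _ fun j _ => hIcos j]
    simp only [cosMean, hΘ, hF, Finset.sum_mul]
  have hK : (∫ X in cellN N L, kin X) =
      ∑ j, ∑ c, ∫ X in cellN N L, ‖fderiv ℝ Ψ.ψ X (Pi.single j (EuclideanSpace.single c 1))‖ ^ 2 := by
    simp_rw [hkin]
    rw [integral_finsetSum _ fun j _ => integrable_finsetSum _ fun c _ => hIa j c]
    exact Finset.sum_congr rfl fun j _ => integral_finsetSum _ fun c _ => hIa j c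
  have hD : (∫ X in cellN N L, sqd X) =
      ∑ j, ∑ c, ∫ X in cellN N L, ‖fderiv ℝ Ψ.ψ X (Pi.single j (EuclideanSpace.single c 1))
        - (u c * Real.sin (Θ j X)) • Ψ.ψ X‖ ^ 2 := by
    simp_rw [hsq]
    rw [integral_finsetSum _ fun j _ => integrable_finsetSum _ fun c _ => hID j c]
    exact Finset.sum_congr rfl fun j _ => integral_finsetSum _ fun c _ => hID j c
  rw [hK, hD, hcm]
  have e3 : (N : ℝ) * t ^ 2 / psq L k = N * (t ^ 2 / psq L k) := by ring
  rw [e3]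
  linarith

/-! ## Registered form -/

/-- **Registered form (helper stub `stub_gaugedSquareIdentity` for `stub_gaugedSquare`).** The
gauged completed square summed over particles and axes, everything inlined: for `L > 0`, `k ≠ 0`,
`t` and a periodic trial state `Ψ`, with `p_c = 2πk_c/L`, `|p|² = psq L k`, `θⱼ(X) = p·xⱼ`,
`∫ ∑_{j,c} |∂_{j,c}Ψ − (t p_c/|p|²) sin θⱼ Ψ|² − N t²/|p|² ≤ ∫ |∇Ψ|² + t ⟨∑ⱼ cos θⱼ⟩_Ψ`
(`gaugedSq_sum`). [folklore] -/
theorem stub_gaugedSquareIdentity :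
    ∀ (N : ℕ) (L : ℝ), 0 < L → ∀ (k : Fin 3 → ℤ), k ≠ 0 → ∀ (t : ℝ) (Ψ : PeriodicTrialState N L),
      (∫ X in cellN N L, ∑ j, ∑ c, ‖fderiv ℝ Ψ.ψ X (Pi.single j (EuclideanSpace.single c 1))
          - (t * (2 * Real.pi / L * k c) / psq L k *
              Real.sin (2 * Real.pi / L * ∑ i, (k i : ℝ) * X j i)) • Ψ.ψ X‖ ^ 2)
        - N * t ^ 2 / psq L k ≤
      (∫ X in cellN N L, ∑ j, ∑ c, ‖fderiv ℝ Ψ.ψ X (Pi.single j (EuclideanSpace.single c 1))‖ ^ 2)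
        + t * cosMean L k Ψ := by
  intro N L hL k hk t Ψ
  choose Θ hΘ using fun j => freeSq_phase_clm (N := N) L k j
  exact gaugedSq_sum hL hk t Ψ Θ (u := fun c => t * (2 * Real.pi / L * k c) / psq L k) hΘ
    (fun _ => rfl) (fun X => by simp only [hΘ]) (fun _ => rfl)

end Summit.AtomisticToContinuum.BoseEinsteinCondensation.Cruxes.StaticResponseBound.FewBody

end
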